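import Literature.IUT.HodgeArakelov.FlSymmetryConjAction
import HarnessLib

/-!
# [IUTchII] Rmk. 1.1.1 (iv): the two sections `s^Θ|_{(l·Δ_Θ)}`, `s^alg|_{(l·Δ_Θ)}` of Rmk. 1.1.1 (iii) are STABLE
# under the conjugation action of `Π_C(M)` (GAP row G-w4d043-2, (iv)-C, part 2 — sequel of `FlSymmetryConjAction`)

Mochizuki, *Inter-universal Teichmüller theory II*, §1, Remark 1.1.1 (iv), kurims manuscript (Dec. 2020) p. 23
l. 26–31: «one verifies easily that … the various subgroups of `Π_M|_{(l·Δ_Θ)(M)}` constructed in (iii) [i.e.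
`Π_μ(M)`, `s^Θ(M)|_{(l·Δ_Θ)}`, `s^alg(M)|_{(l·Δ_Θ)}`] are stabilized by the natural action by `Π_C(M)`»
[claim: Mochizuki2012, status: disputed] (IUTchII §1 Rmk 1.1.1 (iv), kurims p.23); [EtTh] Cor. 2.19 (i) p. 64, Def.
2.13 (i) p. 47 («`s^Θ_Ÿ` … obtained by subtracting `η`», «the natural isomorphism `μ_N ≅ (l·Δ_Θ) ⊗ ℤ/Nℤ`»)
[cite: MochizukiEtTh2009, Cor 2.19 (i) p.64].

Cell abc-iut, seat abc-iut-w4-d018 (gen 6), by-name row «G-w4d043-2 FLSYMMETRY-GENUINE», PROOF-ONLY (0 `def`). For ANY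
`act : Π^tp_C →* MulAut (Π_M|_{(l·Δ_Θ)(M)})` satisfying the PIN of `ModelFrame.exists_conjAct` (conjugation read
through the model embedding: `μ_N`-coordinate through the cyclotomic character of `augC c`, `Π^tp_{Y̲̲}`-coordinate
through `conjX c`) — in particular for THE action constructed there — and the model theta-quotient datum `T`:

* `ModelFrame.envAtTheta_mk_eq_of_toTheta_eq` — two elements of the `(l·Δ_Θ)`-preimage with the same `μ_N`-coordinate
  and the same image in `(Π^tp_X)^Θ` have the same class in `Π_M|_{(l·Δ_Θ)(M)}` (the model theta section is
  `e⁻¹(s^alg(Ker θ))`);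
* **`ModelFrame.conjAct_mk_sTheta`** — `act c` carries the class of `e⁻¹(s^Θ_η(g))` to the class of `e⁻¹(s^Θ_η(c g c⁻¹))`
  (the theta cocycle IS `thetaMod` on `l·Δ_Θ`, root clause `cocycle_lDeltaTheta`, and `thetaMod` intertwines `conjX c`
  with the cyclotomic character — stage 1 `thetaMod_conjX_eq`); **`conjAct_mk_sAlg`** — the same for `s^alg`;
* **`ModelFrame.sTheta_map_conjAct_eq` / `sAlg_map_conjAct_eq`** — for every two-sections datum `Sec` whose sections
  are pinned to the model ones (conjuncts (P1)/(P2) of abc-iut-w4-d043's `exists_twoSections_rigidity_of_coreTower`,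
  p448420), `Sec.sTheta.map (act c) = Sec.sTheta` and `Sec.sAlg.map (act c) = Sec.sAlg` for EVERY `c ∈ Π^tp_C` — the
  typed clauses `FlSymmetry.sTheta_stable` / `sAlg_stable` FOR THE CONJUGATION ACTION.

BINDER CENSUS (BY NAME, no `Prop` fact, no FACT-LIST row): census C4 `cl.InvActsByNegOnEll`, `IsEtThOrigin`, `hYcl`,
`hker`, `hT`, a theta cocycle `η` of the collection. HONEST FRAMING: kernel facts about the cell's own interfaces and
model; the commutator-equivariance clause of Rmk. 1.1.1 (iv) (with the conjugation actions on `Δ_X(M)/Δ_Y(M)` and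
`Δ^ell_Y(M)`) is NOT treated here; Rmk. 1.1.1 is outside the [IUTchIII] Cor. 3.12 cone; no side taken on Cor. 3.12;
typed ≠ proved; constructed ≠ endorsed.
-/

noncomputable section

namespace Literature.IUT.HodgeArakelov

open Literature.AnabelianGeometry.EtaleTheta Literature.AnabelianGeometry.SemiGraphs
open scoped Literature.AnabelianGeometry.EtaleTheta

namespace ModelFrame

variable {p : ℕ} [Fact p.Prime] {Mt : MuTwoSetting p}
  {E : Mt.toThetaSetting.EtaleThetaData} {l : ℕ} (C : E.DoubleUnderline l)
  {S : ThetaSetting.{0}} (μ : Mt.toThetaSetting.CyclotomeMod l S.N)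
  (hC : Mt.toThetaSetting.Compat) (hS : Mt.toThetaSetting.Sec2Hyps)
  (h15 : ThetaSetting.Prop15iii E hC) (L : C.CuspLabels)
  (F : ModelFrame S (C.rigidData μ hC hS h15 L)) {Menv : MonoThetaEnv S}
  (e : Menv.Pi ≃ₜ* (C.rigidData μ hC hS h15 L).env) (cl : Mt.CLevelData)

/-- **Equality of classes in `Π_M|_{(l·Δ_Θ)(M)}` at the model**: for the model theta-quotient datum `T`
(`T.thetaSection = e⁻¹(s^alg(Ker θ))`), two elements of the `(l·Δ_Θ)`-preimage with the same `μ_N`-coordinate and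
the same image in `(Π^tp_X)^Θ` have the same class. [cite: MochizukiEtTh2009, Cor 2.19 (i) p.64] -/
theorem envAtTheta_mk_eq_of_toTheta_eq (T : ThetaQuotientData (F.reconstruction e))
    (hT : T.thetaSection = (((C.rigidData μ hC hS h15 L).thetaKer.subgroupOf (C.rigidData μ hC hS h15 L).PiY).map
        (CycEnvelope.algSection (C.rigidData μ hC hS h15 L).augY (C.rigidData μ hC hS h15 L).chi)).comap
          e.toMulEquiv.toMonoidHom)
    (u v : ↥T.envAtTheta.top) (hl : (e (u : Menv.Pi)).left = (e (v : Menv.Pi)).left)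
    (hr : Mt.toTheta ((((e (u : Menv.Pi)).right : ↥(C.rigidData μ hC hS h15 L).PiY) : ↥C.Huu) : Mt.PiTemp) =
      Mt.toTheta ((((e (v : Menv.Pi)).right : ↥(C.rigidData μ hC hS h15 L).PiY) : ↥C.Huu) : Mt.PiTemp)) :
    (QuotientGroup.mk u : T.envAtTheta.carrier) = QuotientGroup.mk v := by
  set R : RigidData S.N l := C.rigidData μ hC hS h15 L with hRdef
  have hbot : ∀ m : Menv.Pi, m ∈ T.envAtTheta.bot ↔
      e m ∈ ((R.thetaKer.subgroupOf R.PiY).map (CycEnvelope.algSection R.augY R.chi)) := fun m => by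
    change m ∈ T.thetaSection ↔ _
    rw [hT]
    rfl
  have hmemK : ∀ t : ↥C.Huu, t ∈ R.thetaKer ↔ Mt.toTheta (t : Mt.PiTemp) = 1 := fun _ => Iff.rfl
  have hu : (((e (u : Menv.Pi)).right : ↥R.PiY) : ↥C.Huu) ∈ R.lDeltaTheta := u.2
  have hφ : (R.chi.comp R.augY) (e (u : Menv.Pi)).right⁻¹ = 1 := by
    rw [map_inv, chi_augY_eq_one_of_mem_ker (Subgroup.mem_inf.1 (R.lDeltaTheta_le hu)).2, inv_one]
  rw [QuotientGroup.eq, Subgroup.mem_subgroupOf]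
  change ((u : Menv.Pi)⁻¹ * v) ∈ T.envAtTheta.bot
  rw [hbot, map_mul, map_inv]
  refine Subgroup.mem_map.2 ⟨(e (u : Menv.Pi)).right⁻¹ * (e (v : Menv.Pi)).right, ?_, ?_⟩
  · rw [Subgroup.mem_subgroupOf, hmemK, Subgroup.coe_mul, Subgroup.coe_inv, Subgroup.coe_mul, Subgroup.coe_inv,
      map_mul, map_inv, hr, inv_mul_cancel]
  · apply SemidirectProduct.ext
    · rw [SemidirectProduct.mul_left, SemidirectProduct.inv_left, SemidirectProduct.inv_right, hφ,
        MulAut.one_apply, MulAut.one_apply, hl, inv_mul_cancel]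
      rfl
    · rw [SemidirectProduct.mul_right, SemidirectProduct.inv_right]
      rfl

/-- **`s^Θ|_{(l·Δ_Θ)}` is carried to itself, element by element**: for any `act` with the conjugation pin, a theta
cocycle `η` of the collection and `g, g'` in the `(l·Δ_Θ)`-preimage with `g' = c g c⁻¹` in `Π^tp_X`, `act c` maps the
class of `e⁻¹(s^Θ_η g)` to the class of `e⁻¹(s^Θ_η g')` — because `η = thetaMod` on `l·Δ_Θ` (root clause
`cocycle_lDeltaTheta`) and `thetaMod(c g c⁻¹) = χ(augC c) · thetaMod(g)` (stage 1, the cyclotomic character on `Π^tp_C`).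
[claim: Mochizuki2012, status: disputed] (IUTchII §1 Rmk 1.1.1 (iv), kurims p.23) -/
theorem conjAct_mk_sTheta (hinv : cl.InvActsByNegOnEll) (hO : Mt.toThetaSetting.IsEtThOrigin)
    (hYcl : (Mt.DtpY.map Mt.toHat.toMonoidHom).topologicalClosure ≤
      Mt.DtpY.map Mt.toHat.toMonoidHom ⊔ (⁅⁅Mt.DeltaHat, Mt.DeltaHat⁆, Mt.DeltaHat⁆).topologicalClosure)
    (hker : Mt.toTheta.ker ≤ C.Huu) (T : ThetaQuotientData (F.reconstruction e))
    {η : (C.rigidData μ hC hS h15 L).PiYdd → (C.rigidData μ hC hS h15 L).mu}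
    (hη : η ∈ (C.rigidData μ hC hS h15 L).thetaCocycles)
    (act : Mt.GtpC →* MulAut T.envAtTheta.carrier)
    (hpin : ∀ (c : Mt.GtpC) (u v : ↥T.envAtTheta.top),
      (e (v : Menv.Pi)).left = galMuN p S.N (cl.augC c) (e (u : Menv.Pi)).left →
      ((((e (v : Menv.Pi)).right : ↥(C.rigidData μ hC hS h15 L).PiY) : ↥C.Huu) : Mt.PiTemp) =
        cl.conjX c ((((e (u : Menv.Pi)).right : ↥(C.rigidData μ hC hS h15 L).PiY) : ↥C.Huu) : Mt.PiTemp) →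
      act c (QuotientGroup.mk u) = QuotientGroup.mk v)
    (c : Mt.GtpC) (g g' : ↥(C.rigidData μ hC hS h15 L).lDeltaTheta)
    (hgg' : ((g' : ↥C.Huu) : Mt.PiTemp) = cl.conjX c ((g : ↥C.Huu) : Mt.PiTemp))
    (hu : e.symm ((C.rigidData μ hC hS h15 L).toThetaEnvData.sTheta hη
      ⟨(g : (C.rigidData μ hC hS h15 L).PiX),
        (Subgroup.mem_inf.1 ((C.rigidData μ hC hS h15 L).lDeltaTheta_le g.2)).1⟩) ∈ T.envAtTheta.top)
    (hv : e.symm ((C.rigidData μ hC hS h15 L).toThetaEnvData.sTheta hη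
      ⟨(g' : (C.rigidData μ hC hS h15 L).PiX),
        (Subgroup.mem_inf.1 ((C.rigidData μ hC hS h15 L).lDeltaTheta_le g'.2)).1⟩) ∈ T.envAtTheta.top) :
    act c (QuotientGroup.mk (⟨_, hu⟩ : ↥T.envAtTheta.top)) = QuotientGroup.mk ⟨_, hv⟩ := by
  have hleft : ∀ x : ↥(C.rigidData μ hC hS h15 L).PiYdd,
      ((C.rigidData μ hC hS h15 L).toThetaEnvData.sTheta hη x).left = (η x)⁻¹ := fun x => rfl
  have hright : ∀ x : ↥(C.rigidData μ hC hS h15 L).PiYdd,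
      ((((C.rigidData μ hC hS h15 L).toThetaEnvData.sTheta hη x).right : ↥C.Huu) : Mt.PiTemp) =
      ((x : (C.rigidData μ hC hS h15 L).PiX) : Mt.PiTemp) := fun x => rfl
  apply hpin
  · change (e (e.symm _)).left = galMuN p S.N (cl.augC c) (e (e.symm _)).left
    rw [ContinuousMulEquiv.apply_symm_apply, ContinuousMulEquiv.apply_symm_apply, hleft, hleft,
      (C.rigidData μ hC hS h15 L).cocycle_lDeltaTheta η hη _ g'.2,
      (C.rigidData μ hC hS h15 L).cocycle_lDeltaTheta η hη _ g.2, map_inv]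
    congr 1
    have hgL : (⟨(g' : ↥C.Huu), g'.2⟩ : ↥(C.rigidData μ hC hS h15 L).lDeltaTheta) =
        ⟨⟨cl.conjX c ((g : ↥C.Huu) : Mt.PiTemp), C.conjX_mem_Huu_of_mem_lDeltaTheta μ hC hS h15 L cl hker c _ g.2⟩,
          C.conjX_mem_lDeltaTheta μ hC hS h15 L cl hker c _ g.2⟩ := Subtype.ext (Subtype.ext hgg')
    have h := C.thetaMod_conjX_eq μ hC hS h15 L cl hinv hO hYcl hker c (g : ↥C.Huu) g.2
    rw [← hgL] at h
    exact h
  · change ((((e (e.symm _)).right : ↥(C.rigidData μ hC hS h15 L).PiY) : ↥C.Huu) : Mt.PiTemp) =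
      cl.conjX c ((((e (e.symm _)).right : ↥(C.rigidData μ hC hS h15 L).PiY) : ↥C.Huu) : Mt.PiTemp)
    rw [ContinuousMulEquiv.apply_symm_apply, ContinuousMulEquiv.apply_symm_apply, hright, hright]
    exact hgg'

/-- **`s^alg|_{(l·Δ_Θ)}` is carried to itself, element by element**: `act c` maps the class of `e⁻¹(s^alg g)` to
the class of `e⁻¹(s^alg (c g c⁻¹))` (the `μ_N`-coordinate of `s^alg` is `1`).
[claim: Mochizuki2012, status: disputed] (IUTchII §1 Rmk 1.1.1 (iv), kurims p.23) -/
theorem conjAct_mk_sAlg (T : ThetaQuotientData (F.reconstruction e))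
    (act : Mt.GtpC →* MulAut T.envAtTheta.carrier)
    (hpin : ∀ (c : Mt.GtpC) (u v : ↥T.envAtTheta.top),
      (e (v : Menv.Pi)).left = galMuN p S.N (cl.augC c) (e (u : Menv.Pi)).left →
      ((((e (v : Menv.Pi)).right : ↥(C.rigidData μ hC hS h15 L).PiY) : ↥C.Huu) : Mt.PiTemp) =
        cl.conjX c ((((e (u : Menv.Pi)).right : ↥(C.rigidData μ hC hS h15 L).PiY) : ↥C.Huu) : Mt.PiTemp) →
      act c (QuotientGroup.mk u) = QuotientGroup.mk v)
    (c : Mt.GtpC) (g g' : ↥(C.rigidData μ hC hS h15 L).lDeltaTheta)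
    (hgg' : ((g' : ↥C.Huu) : Mt.PiTemp) = cl.conjX c ((g : ↥C.Huu) : Mt.PiTemp))
    (hu : e.symm ((C.rigidData μ hC hS h15 L).toThetaEnvData.sAlg
      ⟨(g : (C.rigidData μ hC hS h15 L).PiX),
        (Subgroup.mem_inf.1 ((C.rigidData μ hC hS h15 L).lDeltaTheta_le g.2)).1⟩) ∈ T.envAtTheta.top)
    (hv : e.symm ((C.rigidData μ hC hS h15 L).toThetaEnvData.sAlg
      ⟨(g' : (C.rigidData μ hC hS h15 L).PiX),
        (Subgroup.mem_inf.1 ((C.rigidData μ hC hS h15 L).lDeltaTheta_le g'.2)).1⟩) ∈ T.envAtTheta.top) :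
    act c (QuotientGroup.mk (⟨_, hu⟩ : ↥T.envAtTheta.top)) = QuotientGroup.mk ⟨_, hv⟩ := by
  have hleft : ∀ x : ↥(C.rigidData μ hC hS h15 L).PiYdd,
      ((C.rigidData μ hC hS h15 L).toThetaEnvData.sAlg x).left = 1 := fun x => rfl
  have hright : ∀ x : ↥(C.rigidData μ hC hS h15 L).PiYdd,
      ((((C.rigidData μ hC hS h15 L).toThetaEnvData.sAlg x).right : ↥C.Huu) : Mt.PiTemp) =
      ((x : (C.rigidData μ hC hS h15 L).PiX) : Mt.PiTemp) := fun x => rfl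
  apply hpin
  · change (e (e.symm _)).left = galMuN p S.N (cl.augC c) (e (e.symm _)).left
    rw [ContinuousMulEquiv.apply_symm_apply, ContinuousMulEquiv.apply_symm_apply, hleft, hleft, map_one]
  · change ((((e (e.symm _)).right : ↥(C.rigidData μ hC hS h15 L).PiY) : ↥C.Huu) : Mt.PiTemp) =
      cl.conjX c ((((e (e.symm _)).right : ↥(C.rigidData μ hC hS h15 L).PiY) : ↥C.Huu) : Mt.PiTemp)
    rw [ContinuousMulEquiv.apply_symm_apply, ContinuousMulEquiv.apply_symm_apply, hright, hright]
    exact hgg'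

/-- **`FlSymmetry.sTheta_stable` FOR THE CONJUGATION ACTION.** For every two-sections datum `Sec` (over any core
tower) whose theta section contains the classes of the model theta section `e⁻¹ ∘ s^Θ_η` on the `(l·Δ_Θ)`-preimage
(conjunct (P1) of `exists_twoSections_rigidity_of_coreTower`, p448420 — then it CONSISTS of them, by bijectivity onto
`(l·Δ_Θ)(M)`), and any `act` with the conjugation pin: `act c (s^Θ|) = s^Θ|` for EVERY `c ∈ Π^tp_C` («the various
subgroups … constructed in (iii) are stabilized by the natural action by `Π_C(M)`»).
[claim: Mochizuki2012, status: disputed] (IUTchII §1 Rmk 1.1.1 (iv), kurims p.23) -/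
theorem sTheta_map_conjAct_eq (hinv : cl.InvActsByNegOnEll) (hO : Mt.toThetaSetting.IsEtThOrigin)
    (hYcl : (Mt.DtpY.map Mt.toHat.toMonoidHom).topologicalClosure ≤
      Mt.DtpY.map Mt.toHat.toMonoidHom ⊔ (⁅⁅Mt.DeltaHat, Mt.DeltaHat⁆, Mt.DeltaHat⁆).topologicalClosure)
    (hker : Mt.toTheta.ker ≤ C.Huu) (T : ThetaQuotientData (F.reconstruction e)) {W : CoreTower (F.reconstruction e)}
    (Sec : TwoSections T W)
    {η : (C.rigidData μ hC hS h15 L).PiYdd → (C.rigidData μ hC hS h15 L).mu}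
    (hη : η ∈ (C.rigidData μ hC hS h15 L).thetaCocycles)
    (hP1 : ∀ g : ↥(C.rigidData μ hC hS h15 L).lDeltaTheta,
      ∃ hg : e.symm ((C.rigidData μ hC hS h15 L).toThetaEnvData.sTheta hη
          ⟨(g : (C.rigidData μ hC hS h15 L).PiX),
            (Subgroup.mem_inf.1 ((C.rigidData μ hC hS h15 L).lDeltaTheta_le g.2)).1⟩) ∈ T.envAtTheta.top,
        (QuotientGroup.mk (⟨_, hg⟩ : ↥T.envAtTheta.top) : T.envAtTheta.carrier) ∈ Sec.sTheta)
    (act : Mt.GtpC →* MulAut T.envAtTheta.carrier)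
    (hpin : ∀ (c : Mt.GtpC) (u v : ↥T.envAtTheta.top),
      (e (v : Menv.Pi)).left = galMuN p S.N (cl.augC c) (e (u : Menv.Pi)).left →
      ((((e (v : Menv.Pi)).right : ↥(C.rigidData μ hC hS h15 L).PiY) : ↥C.Huu) : Mt.PiTemp) =
        cl.conjX c ((((e (u : Menv.Pi)).right : ↥(C.rigidData μ hC hS h15 L).PiY) : ↥C.Huu) : Mt.PiTemp) →
      act c (QuotientGroup.mk u) = QuotientGroup.mk v)
    (c : Mt.GtpC) : Sec.sTheta.map (act c).toMonoidHom = Sec.sTheta := by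
  classical
  -- the image in `(l·Δ_Θ)(M)` of the class of `e⁻¹(s^Θ_η g)` is the class of `g`
  have hproj : ∀ u : ↥T.envAtTheta.top, T.proj (QuotientGroup.mk u) =
      QuotientGroup.mk (⟨(F.reconstruction e).projY (u : Menv.Pi), u.2⟩ : ↥(F.reconstruction e).intCyc.top) := by
    intro u
    rw [ThetaQuotientData.proj, QuotientGroup.map_mk]
    rfl
  have hprojΘ : ∀ (g : ↥(C.rigidData μ hC hS h15 L).lDeltaTheta) (hg : e.symm
      ((C.rigidData μ hC hS h15 L).toThetaEnvData.sTheta hη ⟨(g : (C.rigidData μ hC hS h15 L).PiX),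
        (Subgroup.mem_inf.1 ((C.rigidData μ hC hS h15 L).lDeltaTheta_le g.2)).1⟩) ∈ T.envAtTheta.top),
      T.proj (QuotientGroup.mk (⟨_, hg⟩ : ↥T.envAtTheta.top)) =
        QuotientGroup.mk (⟨⟨(g : ↥C.Huu), (C.rigidData μ hC hS h15 L).PiYdd_le
          (Subgroup.mem_inf.1 ((C.rigidData μ hC hS h15 L).lDeltaTheta_le g.2)).1⟩, g.2⟩ :
            ↥(F.reconstruction e).intCyc.top) := by
    intro g hg
    rw [hproj]
    congr 1
    apply Subtype.ext
    change (e (e.symm _)).right = _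
    rw [ContinuousMulEquiv.apply_symm_apply]
    rfl
  -- (P1) characterises `Sec.sTheta`
  have hchar : ∀ s ∈ Sec.sTheta, ∃ (g : ↥(C.rigidData μ hC hS h15 L).lDeltaTheta) (hg : e.symm
      ((C.rigidData μ hC hS h15 L).toThetaEnvData.sTheta hη ⟨(g : (C.rigidData μ hC hS h15 L).PiX),
        (Subgroup.mem_inf.1 ((C.rigidData μ hC hS h15 L).lDeltaTheta_le g.2)).1⟩) ∈ T.envAtTheta.top),
      s = QuotientGroup.mk (⟨_, hg⟩ : ↥T.envAtTheta.top) := by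
    intro s hs
    obtain ⟨gq, hgq⟩ := QuotientGroup.mk_surjective (T.proj s)
    let g : ↥(C.rigidData μ hC hS h15 L).lDeltaTheta := ⟨((gq : ↥(C.rigidData μ hC hS h15 L).PiY) : ↥C.Huu), gq.2⟩
    obtain ⟨hg, hmem⟩ := hP1 g
    refine ⟨g, hg, Sec.sTheta_bijOn.2.1 hs hmem ?_⟩
    rw [hprojΘ, ← hgq]
  -- conjugating the parameter
  have hconj : ∀ (d : Mt.GtpC) (g : ↥(C.rigidData μ hC hS h15 L).lDeltaTheta),
      ∃ g' : ↥(C.rigidData μ hC hS h15 L).lDeltaTheta, ((g' : ↥C.Huu) : Mt.PiTemp) = cl.conjX d ((g : ↥C.Huu) : Mt.PiTemp) :=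
    fun d g => ⟨⟨⟨cl.conjX d ((g : ↥C.Huu) : Mt.PiTemp), C.conjX_mem_Huu_of_mem_lDeltaTheta μ hC hS h15 L cl hker d _ g.2⟩,
      C.conjX_mem_lDeltaTheta μ hC hS h15 L cl hker d _ g.2⟩, rfl⟩
  ext s
  constructor
  · rintro ⟨s₀, hs₀, rfl⟩
    obtain ⟨g, hg, rfl⟩ := hchar s₀ hs₀
    obtain ⟨g', hgg'⟩ := hconj c g
    obtain ⟨hg', hmem'⟩ := hP1 g'
    change act c _ ∈ Sec.sTheta
    rw [conjAct_mk_sTheta C μ hC hS h15 L F e cl hinv hO hYcl hker T hη act hpin c g g' hgg' hg hg']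
    exact hmem'
  · intro hs
    obtain ⟨g, hg, rfl⟩ := hchar s hs
    obtain ⟨g₀, hg₀g⟩ := hconj c⁻¹ g
    obtain ⟨hg₀, hmem₀⟩ := hP1 g₀
    have hgg : ((g : ↥C.Huu) : Mt.PiTemp) = cl.conjX c ((g₀ : ↥C.Huu) : Mt.PiTemp) := by
      rw [hg₀g, ← cl.conjX_mul, mul_inv_cancel, cl.conjX_one]
    refine ⟨_, hmem₀, ?_⟩
    change act c _ = _
    exact conjAct_mk_sTheta C μ hC hS h15 L F e cl hinv hO hYcl hker T hη act hpin c g₀ g hgg hg₀ hg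

/-- **`FlSymmetry.sAlg_stable` FOR THE CONJUGATION ACTION.** For the model theta-quotient datum `T`, every
two-sections datum `Sec` whose algebraic section consists of classes of the model algebraic section `e⁻¹ ∘ s^alg` on the
`(l·Δ_Θ)`-preimage (conjunct (P2) of p448420), and any `act` with the conjugation pin: `act c (s^alg|) = s^alg|` for
EVERY `c ∈ Π^tp_C`. [claim: Mochizuki2012, status: disputed] (IUTchII §1 Rmk 1.1.1 (iv), kurims p.23) -/
theorem sAlg_map_conjAct_eq (hker : Mt.toTheta.ker ≤ C.Huu) (T : ThetaQuotientData (F.reconstruction e))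
    (hT : T.thetaSection = (((C.rigidData μ hC hS h15 L).thetaKer.subgroupOf (C.rigidData μ hC hS h15 L).PiY).map
        (CycEnvelope.algSection (C.rigidData μ hC hS h15 L).augY (C.rigidData μ hC hS h15 L).chi)).comap
          e.toMulEquiv.toMonoidHom)
    {W : CoreTower (F.reconstruction e)} (Sec : TwoSections T W)
    (hP2 : ∀ s ∈ Sec.sAlg, ∃ (g : ↥(C.rigidData μ hC hS h15 L).lDeltaTheta)
      (hg : e.symm ((C.rigidData μ hC hS h15 L).toThetaEnvData.sAlg
          ⟨(g : (C.rigidData μ hC hS h15 L).PiX),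
            (Subgroup.mem_inf.1 ((C.rigidData μ hC hS h15 L).lDeltaTheta_le g.2)).1⟩) ∈ T.envAtTheta.top),
        s = (QuotientGroup.mk (⟨_, hg⟩ : ↥T.envAtTheta.top) : T.envAtTheta.carrier))
    (act : Mt.GtpC →* MulAut T.envAtTheta.carrier)
    (hpin : ∀ (c : Mt.GtpC) (u v : ↥T.envAtTheta.top),
      (e (v : Menv.Pi)).left = galMuN p S.N (cl.augC c) (e (u : Menv.Pi)).left →
      ((((e (v : Menv.Pi)).right : ↥(C.rigidData μ hC hS h15 L).PiY) : ↥C.Huu) : Mt.PiTemp) =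
        cl.conjX c ((((e (u : Menv.Pi)).right : ↥(C.rigidData μ hC hS h15 L).PiY) : ↥C.Huu) : Mt.PiTemp) →
      act c (QuotientGroup.mk u) = QuotientGroup.mk v)
    (c : Mt.GtpC) : Sec.sAlg.map (act c).toMonoidHom = Sec.sAlg := by
  classical
  have hleft : ∀ x : ↥(C.rigidData μ hC hS h15 L).PiYdd,
      ((C.rigidData μ hC hS h15 L).toThetaEnvData.sAlg x).left = 1 := fun x => rfl
  have hmemK : ∀ t : ↥C.Huu, t ∈ (C.rigidData μ hC hS h15 L).thetaKer ↔ Mt.toTheta (t : Mt.PiTemp) = 1 :=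
    fun _ => Iff.rfl
  have hproj : ∀ u : ↥T.envAtTheta.top, T.proj (QuotientGroup.mk u) =
      QuotientGroup.mk (⟨(F.reconstruction e).projY (u : Menv.Pi), u.2⟩ : ↥(F.reconstruction e).intCyc.top) := by
    intro u
    rw [ThetaQuotientData.proj, QuotientGroup.map_mk]
    rfl
  -- every element of the preimage parametrises a point of the top group
  have htopA : ∀ g : ↥(C.rigidData μ hC hS h15 L).lDeltaTheta, e.symm ((C.rigidData μ hC hS h15 L).toThetaEnvData.sAlg
      ⟨(g : (C.rigidData μ hC hS h15 L).PiX),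
        (Subgroup.mem_inf.1 ((C.rigidData μ hC hS h15 L).lDeltaTheta_le g.2)).1⟩) ∈ T.envAtTheta.top := by
    intro g
    change (((e (e.symm _)).right : ↥C.Huu)) ∈ (C.rigidData μ hC hS h15 L).lDeltaTheta
    rw [ContinuousMulEquiv.apply_symm_apply]
    exact g.2
  have hprojA : ∀ (g : ↥(C.rigidData μ hC hS h15 L).lDeltaTheta) (hg : e.symm
      ((C.rigidData μ hC hS h15 L).toThetaEnvData.sAlg ⟨(g : (C.rigidData μ hC hS h15 L).PiX),
        (Subgroup.mem_inf.1 ((C.rigidData μ hC hS h15 L).lDeltaTheta_le g.2)).1⟩) ∈ T.envAtTheta.top),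
      T.proj (QuotientGroup.mk (⟨_, hg⟩ : ↥T.envAtTheta.top)) =
        QuotientGroup.mk (⟨⟨(g : ↥C.Huu), (C.rigidData μ hC hS h15 L).PiYdd_le
          (Subgroup.mem_inf.1 ((C.rigidData μ hC hS h15 L).lDeltaTheta_le g.2)).1⟩, g.2⟩ :
            ↥(F.reconstruction e).intCyc.top) := by
    intro g hg
    rw [hproj]
    congr 1
    apply Subtype.ext
    change (e (e.symm _)).right = _
    rw [ContinuousMulEquiv.apply_symm_apply]
    rfl
  -- the classes of `e⁻¹(s^alg g)` all belong to `Sec.sAlg` (surjectivity onto `(l·Δ_Θ)(M)` + (P2))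
  have hmemA : ∀ g : ↥(C.rigidData μ hC hS h15 L).lDeltaTheta,
      (QuotientGroup.mk (⟨_, htopA g⟩ : ↥T.envAtTheta.top) : T.envAtTheta.carrier) ∈ Sec.sAlg := by
    intro g
    obtain ⟨s, hs, hps⟩ := Sec.sAlg_bijOn.2.2 (Set.mem_univ (T.proj (QuotientGroup.mk (⟨_, htopA g⟩ : ↥T.envAtTheta.top))))
    obtain ⟨g'', hg'', rfl⟩ := hP2 s hs
    rw [hprojA, hprojA, QuotientGroup.eq, Subgroup.mem_subgroupOf] at hps
    have hK : ((g'' : ↥C.Huu)⁻¹ * (g : ↥C.Huu)) ∈ (C.rigidData μ hC hS h15 L).thetaKer := hps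
    rw [hmemK, Subgroup.coe_mul, Subgroup.coe_inv, map_mul, map_inv, inv_mul_eq_one] at hK
    have heq := envAtTheta_mk_eq_of_toTheta_eq C μ hC hS h15 L F e T hT ⟨_, hg''⟩ ⟨_, htopA g⟩
      (by
        change (e (e.symm _)).left = (e (e.symm _)).left
        rw [ContinuousMulEquiv.apply_symm_apply, ContinuousMulEquiv.apply_symm_apply, hleft, hleft])
      (by
        change Mt.toTheta ((((e (e.symm _)).right : ↥(C.rigidData μ hC hS h15 L).PiY) : ↥C.Huu) : Mt.PiTemp) =
          Mt.toTheta ((((e (e.symm _)).right : ↥(C.rigidData μ hC hS h15 L).PiY) : ↥C.Huu) : Mt.PiTemp)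
        rw [ContinuousMulEquiv.apply_symm_apply, ContinuousMulEquiv.apply_symm_apply]
        exact hK)
    rw [← heq]
    exact hs
  have hconj : ∀ (d : Mt.GtpC) (g : ↥(C.rigidData μ hC hS h15 L).lDeltaTheta),
      ∃ g' : ↥(C.rigidData μ hC hS h15 L).lDeltaTheta, ((g' : ↥C.Huu) : Mt.PiTemp) = cl.conjX d ((g : ↥C.Huu) : Mt.PiTemp) :=
    fun d g => ⟨⟨⟨cl.conjX d ((g : ↥C.Huu) : Mt.PiTemp), C.conjX_mem_Huu_of_mem_lDeltaTheta μ hC hS h15 L cl hker d _ g.2⟩,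
      C.conjX_mem_lDeltaTheta μ hC hS h15 L cl hker d _ g.2⟩, rfl⟩
  ext s
  constructor
  · rintro ⟨s₀, hs₀, rfl⟩
    obtain ⟨g, hg, rfl⟩ := hP2 s₀ hs₀
    obtain ⟨g', hgg'⟩ := hconj c g
    change act c _ ∈ Sec.sAlg
    rw [conjAct_mk_sAlg C μ hC hS h15 L F e cl T act hpin c g g' hgg' hg (htopA g')]
    exact hmemA g'
  · intro hs
    obtain ⟨g, hg, rfl⟩ := hP2 s hs
    obtain ⟨g₀, hg₀g⟩ := hconj c⁻¹ g
    have hgg : ((g : ↥C.Huu) : Mt.PiTemp) = cl.conjX c ((g₀ : ↥C.Huu) : Mt.PiTemp) := by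
      rw [hg₀g, ← cl.conjX_mul, mul_inv_cancel, cl.conjX_one]
    refine ⟨_, hmemA g₀, ?_⟩
    change act c _ = _
    exact conjAct_mk_sAlg C μ hC hS h15 L F e cl T act hpin c g₀ g hgg (htopA g₀) hg

end ModelFrame

end Literature.IUT.HodgeArakelov

end
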